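import Summits.QuantumFields.QCD.Theses.SpectralDefectExtinction
import Literature.MathematicalPhysics.QuantumFieldTheory.QCDPhaseQuenched
import Literature.MathematicalPhysics.QuantumFieldTheory.SpectralDefectDensity
import Literature.Barriers.QuantumFields.WilsonDeterminantMassSplitting
import Summits.QuantumFields.QCD.Theorems.SpectralDefectExtinctionWegnerEstimateStubRecentreGeometry
import Summits.QuantumFields.QCD.Theorems.SpectralDefectExtinctionWegnerEstimateStubDiracLocality

/-!
# Stub `recentreDirac` of line `Sketch` (skeleton "ResolventCell") for crux
`SpectralDefectExtinction.WegnerEstimate` (item stmt-QuantumFields-8966)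

Seam bookkeeping for the recentring step of the exterior elimination.  Let `L₀ = 2R+3 ≤ L - 1`,
`x` a site of the big torus `(ZMod L)^4`, and `σ s := x + proj_L (valMinAbs ∘ s)` the recentring of
the small torus `(ZMod L₀)^4` onto the radius-`(R+1)` cube around `x` (`stub_recentreGeometry`),
extended to edges by `ι (s, μ) := (σ s, μ)`.  For the Hermitian Wilson–Dirac matrix
`H^{(L)}(W) = Γ₅ D_W(W, m, 1)` we show

  `H^{(L)}(W) (σ p.1, p.2) (σ q.1, q.2) = H^{(L₀)}(W ∘ ι) p q + sign(p) · (seam hops of W ∘ ι) p q`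

(`recentreDirac_gammaFive_sample`): a hop `q.1 = p.1 + μ̂` of the small torus is a hop
`σ q.1 = σ p.1 + μ̂` of the big torus unless it crosses the seam `valMinAbs (p.1 μ) = R+1`
(`recentreDirac_sigma_eq_shift_iff`), and conversely; the diagonal terms match by injectivity of
`σ`.  The seam hops involve only links based at recentred seam sites, which lie off the cell cube
`x + proj_L(box 4 R)` (where the glued configuration reads the exterior `U`), and both endpoints of
a seam hop lie off the cube `0 + proj_{L₀}(box 4 R)`.  Taking
`Θ := H^{(L₀)}(U ∘ ι, 0) - H^{(L)}(U, 0) ∘ (σ × σ)` (Hermitian as a difference of a Hermitian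
matrix and a principal reindexing of one) gives the stub.
-/

noncomputable section

namespace Summit.QuantumFields.QCD.Cruxes.WegnerEstimate.ResolventCell

open MeasureTheory
open scoped Matrix BigOperators
open Literature.MathematicalPhysics.QuantumLattice Literature.MathematicalPhysics.QuantumFieldTheory
  Literature.Probability.LatticeModels
open Literature.Barriers.QuantumFields (isHermitian_gammaFive_mul_wilsonDirac)
open Matrix
open scoped ComplexOrder

/-! ### Balanced representatives on the `(2R+3)`-torus -/

/-- Two integers of absolute values `≤ R+1` and `≤ R+2` with the same residue mod `L ≥ 2R+4` are
equal. -/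
theorem recentreDirac_intCast_eq (R L : ℕ) (hL : 2 * R + 4 ≤ L) (a b : ℤ)
    (ha : |a| ≤ (R : ℤ) + 1) (hb : |b| ≤ (R : ℤ) + 2) (h : (a : ZMod L) = (b : ZMod L)) :
    a = b := by
  rw [ZMod.intCast_eq_intCast_iff_dvd_sub] at h
  rw [abs_le] at ha hb
  have h0 : b - a = 0 := by
    refine Int.eq_zero_of_abs_lt_dvd h ?_
    rw [abs_lt]
    constructor <;> omega
  omega

/-- No wrap: away from the seam `valMinAbs = R+1`, the hop `s ↦ s + 1` of the `(2R+3)`-torus adds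
`1` to the balanced representative. -/
theorem recentreDirac_valMinAbs_add_one (R : ℕ) (s : ZMod (2 * R + 3))
    (hs : s.valMinAbs ≠ (R : ℤ) + 1) : (s + 1).valMinAbs = s.valMinAbs + 1 := by
  have hle := recentreGeometry_abs_valMinAbs_le R s
  have h1 : |s.valMinAbs + 1| ≤ (R : ℤ) + 1 := by
    rw [abs_le] at hle ⊢
    constructor <;> omega
  have h2 : s + 1 = ((s.valMinAbs + 1 : ℤ) : ZMod (2 * R + 3)) := by
    rw [Int.cast_add, Int.cast_one, ZMod.coe_valMinAbs]
  rw [h2, recentreGeometry_valMinAbs_intCast R _ h1]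

/-- Wrap: across the seam `valMinAbs = R+1`, the hop `s ↦ s + 1` of the `(2R+3)`-torus lands on the
balanced representative `-(R+1)`. -/
theorem recentreDirac_valMinAbs_add_one_of_eq (R : ℕ) (s : ZMod (2 * R + 3))
    (hs : s.valMinAbs = (R : ℤ) + 1) : (s + 1).valMinAbs = -((R : ℤ) + 1) := by
  have h2 : s + 1 = ((-((R : ℤ) + 1) : ℤ) : ZMod (2 * R + 3)) := by
    calc s + 1 = ((s.valMinAbs : ℤ) : ZMod (2 * R + 3)) + ((1 : ℤ) : ZMod (2 * R + 3)) := by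
          rw [ZMod.coe_valMinAbs, Int.cast_one]
      _ = (((R : ℤ) + 1 + 1 : ℤ) : ZMod (2 * R + 3)) := by rw [hs, ← Int.cast_add]
      _ = ((-((R : ℤ) + 1) : ℤ) : ZMod (2 * R + 3)) := by
          rw [ZMod.intCast_eq_intCast_iff_dvd_sub]
          exact ⟨-1, by push_cast; ring⟩
  rw [h2]
  refine recentreGeometry_valMinAbs_intCast R _ ?_
  rw [abs_neg]
  exact (abs_of_nonneg (by positivity)).le

/-- Sites of the cube `0 + proj(box 4 R)` of the `(2R+3)`-torus have all balanced coordinates of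
absolute value `≤ R`. -/
theorem recentreDirac_abs_valMinAbs_le_of_mem (R : ℕ) {s : TorusSite 4 (2 * R + 3)}
    (hs : ∃ y ∈ box 4 R, s = 0 + Torus.proj (2 * R + 3) y) (i : Fin 4) :
    |(s i).valMinAbs| ≤ (R : ℤ) := by
  obtain ⟨y, hy, rfl⟩ := hs
  rw [recentreGeometry_mem_box_iff] at hy
  rw [zero_add, Torus.proj_apply,
    recentreGeometry_valMinAbs_intCast R (y i) ((hy i).trans (by linarith))]
  exact hy i

/-- Both endpoints of a hop `t = s + μ̂` of the `(2R+3)`-torus across the seam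
(`valMinAbs (s μ) = R+1`, so `valMinAbs (t μ) = -(R+1)`) lie off the cube `0 + proj(box 4 R)`. -/
theorem recentreDirac_seam_not_mem (R : ℕ) {s t : TorusSite 4 (2 * R + 3)} {μ : Fin 4}
    (ht : t = Site.shift s μ) (h : (s μ).valMinAbs = (R : ℤ) + 1) :
    (¬ ∃ y ∈ box 4 R, s = 0 + Torus.proj (2 * R + 3) y) ∧
      ¬ ∃ y ∈ box 4 R, t = 0 + Torus.proj (2 * R + 3) y := by
  refine ⟨fun hmem => ?_, fun hmem => ?_⟩
  · have h1 := recentreDirac_abs_valMinAbs_le_of_mem R hmem μ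
    rw [h, abs_le] at h1
    omega
  · have h1 := recentreDirac_abs_valMinAbs_le_of_mem R hmem μ
    rw [ht, Literature.MathematicalPhysics.QuantumFieldTheory.Site.shift, Pi.add_apply,
      Pi.single_eq_same, recentreDirac_valMinAbs_add_one_of_eq R _ h, abs_neg, abs_le] at h1
    omega

/-! ### The recentring and nearest-neighbour hops -/

/-- The recentring `σ s = x + proj_L (valMinAbs ∘ s)` carries a hop `t = s + μ̂` of the
`(2R+3)`-torus to a hop `σ t = σ s + μ̂` of the `L`-torus (`L ≥ 2R+4`) exactly when the hop does
not cross the seam (`valMinAbs (s μ) ≠ R+1`), and every hop `σ t = σ s + μ̂` arises this way. -/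
theorem recentreDirac_sigma_eq_shift_iff (R L : ℕ) (hL : 2 * R + 4 ≤ L) (x : TorusSite 4 L)
    (s t : TorusSite 4 (2 * R + 3)) (μ : Fin 4) :
    x + Torus.proj L (fun i => ((t i).valMinAbs : ℤ)) =
        Site.shift (x + Torus.proj L (fun i => ((s i).valMinAbs : ℤ))) μ ↔
      t = Site.shift s μ ∧ (s μ).valMinAbs ≠ (R : ℤ) + 1 := by
  rw [Literature.MathematicalPhysics.QuantumFieldTheory.Site.shift,
    Literature.MathematicalPhysics.QuantumFieldTheory.Site.shift, add_assoc, add_right_inj]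
  constructor
  · intro h
    have hμ : (t μ).valMinAbs = (s μ).valMinAbs + 1 := by
      have hi := congr_fun h μ
      simp only [Pi.add_apply, Torus.proj_apply, Pi.single_eq_same] at hi
      refine recentreDirac_intCast_eq R L hL _ _ (recentreGeometry_abs_valMinAbs_le R (t μ)) ?_
        (by push_cast; exact hi)
      have hle := recentreGeometry_abs_valMinAbs_le R (s μ)
      rw [abs_le] at hle ⊢
      constructor <;> omega
    have hne : (s μ).valMinAbs ≠ (R : ℤ) + 1 := by
      have hle := recentreGeometry_abs_valMinAbs_le R (t μ)
      rw [abs_le] at hle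
      omega
    refine ⟨funext fun i => ?_, hne⟩
    by_cases hi : i = μ
    · subst hi
      rw [Pi.add_apply, Pi.single_eq_same, ← ZMod.valMinAbs_inj,
        recentreDirac_valMinAbs_add_one R _ hne, hμ]
    · have h' := congr_fun h i
      simp only [Pi.add_apply, Torus.proj_apply, Pi.single_eq_of_ne hi, add_zero] at h'
      rw [Pi.add_apply, Pi.single_eq_of_ne hi, add_zero, ← ZMod.valMinAbs_inj]
      exact recentreGeometry_intCast_eq R L hL _ _ (recentreGeometry_abs_valMinAbs_le R (t i))
        (recentreGeometry_abs_valMinAbs_le R (s i)) h'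
  · rintro ⟨rfl, hne⟩
    funext i
    by_cases hi : i = μ
    · subst hi
      simp only [Pi.add_apply, Torus.proj_apply, Pi.single_eq_same,
        recentreDirac_valMinAbs_add_one R _ hne, Int.cast_add, Int.cast_one]
    · simp only [Pi.add_apply, Torus.proj_apply, Pi.single_eq_of_ne hi, add_zero]

/-! ### The seam formula for the Wilson–Dirac matrix -/

/-- **Seam formula for `D_W`.**  Sampled at recentred indices, the Wilson–Dirac matrix of a
configuration `W` of the `L`-torus is the Wilson–Dirac matrix of the pulled-back configuration
`W ∘ ι` on the `(2R+3)`-torus plus the hops of the latter across its seam: the diagonal terms match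
(`σ` is injective), a hop `σ q.1 = σ p.1 + μ̂` of the big torus is exactly a non-seam hop
`q.1 = p.1 + μ̂` of the small one, through the same link `W (σ p.1, μ) = (W ∘ ι) (p.1, μ)`, and the
seam hops of the small torus are left over. -/
theorem recentreDirac_wilsonDirac_sample (R L : ℕ) [NeZero L] (hL : 2 * R + 4 ≤ L)
    (x : TorusSite 4 L) (W : GaugeConfig 4 L SU3) (m : ℝ) (p q : QuarkIdx (2 * R + 3)) :
    wilsonDirac (fundamentalRep (Fin 3)) W m 1
        (x + Torus.proj L (fun i => ((p.1 i).valMinAbs : ℤ)), p.2)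
        (x + Torus.proj L (fun i => ((q.1 i).valMinAbs : ℤ)), q.2) =
      wilsonDirac (fundamentalRep (Fin 3))
          (fun e : Edge 4 (2 * R + 3) =>
            W (x + Torus.proj L (fun i => ((e.1 i).valMinAbs : ℤ)), e.2)) m 1 p q +
        (1 / 2 : ℂ) * ∑ μ : Fin 4,
          ((if q.1 = Site.shift p.1 μ ∧ (p.1 μ).valMinAbs = (R : ℤ) + 1 then
              (((1 : ℝ) : ℂ) • (1 : Matrix (Fin 4) (Fin 4) ℂ) - euclideanGamma μ) p.2.2 q.2.2 *
                fundamentalRep (Fin 3)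
                  (W (x + Torus.proj L (fun i => ((p.1 i).valMinAbs : ℤ)), μ)) p.2.1 q.2.1
            else 0) +
            (if p.1 = Site.shift q.1 μ ∧ (q.1 μ).valMinAbs = (R : ℤ) + 1 then
              (((1 : ℝ) : ℂ) • (1 : Matrix (Fin 4) (Fin 4) ℂ) + euclideanGamma μ) p.2.2 q.2.2 *
                fundamentalRep (Fin 3)
                  (W (x + Torus.proj L (fun i => ((q.1 i).valMinAbs : ℤ)), μ))⁻¹ p.2.1 q.2.1
            else 0)) := by
  haveI : NeZero (2 * R + 3) := ⟨by omega⟩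
  obtain ⟨hinj, -, -, -⟩ := stub_recentreGeometry R (2 * R + 3) rfl L hL x
  have hdiag : ((x + Torus.proj L (fun i => ((p.1 i).valMinAbs : ℤ)), p.2) : QuarkIdx L) =
      (x + Torus.proj L (fun i => ((q.1 i).valMinAbs : ℤ)), q.2) ↔ p = q := by
    constructor
    · intro h
      rw [Prod.mk.injEq] at h
      exact Prod.ext (hinj h.1) h.2
    · rintro rfl
      rfl
  simp only [wilsonDirac, Matrix.of_apply, hdiag, recentreDirac_sigma_eq_shift_iff R L hL x,
    ite_and, ite_not]
  rw [sub_add, ← mul_sub, ← Finset.sum_sub_distrib]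
  congr 2
  refine Finset.sum_congr rfl fun μ _ => ?_
  split_ifs <;> ring

/-- **Seam formula for `H = Γ₅ D_W`** (rows of the previous formula multiplied by the signs
`γ₅ = diag(1, 1, -1, -1)`). -/
theorem recentreDirac_gammaFive_sample (R L : ℕ) [NeZero L] [NeZero (2 * R + 3)]
    (hL : 2 * R + 4 ≤ L) (x : TorusSite 4 L) (W : GaugeConfig 4 L SU3) (m : ℝ)
    (p q : QuarkIdx (2 * R + 3)) :
    (spinorLift gammaFive * wilsonDirac (fundamentalRep (Fin 3)) W m 1 :
        Matrix (QuarkIdx L) (QuarkIdx L) ℂ)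
        (x + Torus.proj L (fun i => ((p.1 i).valMinAbs : ℤ)), p.2)
        (x + Torus.proj L (fun i => ((q.1 i).valMinAbs : ℤ)), q.2) =
      (spinorLift gammaFive * wilsonDirac (fundamentalRep (Fin 3))
          (fun e : Edge 4 (2 * R + 3) =>
            W (x + Torus.proj L (fun i => ((e.1 i).valMinAbs : ℤ)), e.2)) m 1 :
        Matrix (QuarkIdx (2 * R + 3)) (QuarkIdx (2 * R + 3)) ℂ) p q +
        (![1, 1, -1, -1] : Fin 4 → ℂ) p.2.2 * ((1 / 2 : ℂ) * ∑ μ : Fin 4,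
          ((if q.1 = Site.shift p.1 μ ∧ (p.1 μ).valMinAbs = (R : ℤ) + 1 then
              (((1 : ℝ) : ℂ) • (1 : Matrix (Fin 4) (Fin 4) ℂ) - euclideanGamma μ) p.2.2 q.2.2 *
                fundamentalRep (Fin 3)
                  (W (x + Torus.proj L (fun i => ((p.1 i).valMinAbs : ℤ)), μ)) p.2.1 q.2.1
            else 0) +
            (if p.1 = Site.shift q.1 μ ∧ (q.1 μ).valMinAbs = (R : ℤ) + 1 then
              (((1 : ℝ) : ℂ) • (1 : Matrix (Fin 4) (Fin 4) ℂ) + euclideanGamma μ) p.2.2 q.2.2 *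
                fundamentalRep (Fin 3)
                  (W (x + Torus.proj L (fun i => ((q.1 i).valMinAbs : ℤ)), μ))⁻¹ p.2.1 q.2.1
            else 0))) := by
  rw [spinorLift_gammaFive_eq_diagonal, spinorLift_gammaFive_eq_diagonal, diagonal_mul,
    diagonal_mul, recentreDirac_wilsonDirac_sample R L hL x W m p q, mul_add]

/-- The seam hops only involve links based at recentred seam sites: two configurations of the
`L`-torus agreeing on those links have the same seam hops. -/
theorem recentreDirac_seam_congr (R L : ℕ) (x : TorusSite 4 L) (W W' : GaugeConfig 4 L SU3)
    (h : ∀ (s : TorusSite 4 (2 * R + 3)) (μ : Fin 4), (s μ).valMinAbs = (R : ℤ) + 1 →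
      W (x + Torus.proj L (fun i => ((s i).valMinAbs : ℤ)), μ) =
        W' (x + Torus.proj L (fun i => ((s i).valMinAbs : ℤ)), μ))
    (p q : QuarkIdx (2 * R + 3)) :
    (∑ μ : Fin 4,
        ((if q.1 = Site.shift p.1 μ ∧ (p.1 μ).valMinAbs = (R : ℤ) + 1 then
            (((1 : ℝ) : ℂ) • (1 : Matrix (Fin 4) (Fin 4) ℂ) - euclideanGamma μ) p.2.2 q.2.2 *
              fundamentalRep (Fin 3)
                (W (x + Torus.proj L (fun i => ((p.1 i).valMinAbs : ℤ)), μ)) p.2.1 q.2.1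
          else 0) +
          (if p.1 = Site.shift q.1 μ ∧ (q.1 μ).valMinAbs = (R : ℤ) + 1 then
            (((1 : ℝ) : ℂ) • (1 : Matrix (Fin 4) (Fin 4) ℂ) + euclideanGamma μ) p.2.2 q.2.2 *
              fundamentalRep (Fin 3)
                (W (x + Torus.proj L (fun i => ((q.1 i).valMinAbs : ℤ)), μ))⁻¹ p.2.1 q.2.1
          else 0))) =
      ∑ μ : Fin 4,
        ((if q.1 = Site.shift p.1 μ ∧ (p.1 μ).valMinAbs = (R : ℤ) + 1 then
            (((1 : ℝ) : ℂ) • (1 : Matrix (Fin 4) (Fin 4) ℂ) - euclideanGamma μ) p.2.2 q.2.2 *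
              fundamentalRep (Fin 3)
                (W' (x + Torus.proj L (fun i => ((p.1 i).valMinAbs : ℤ)), μ)) p.2.1 q.2.1
          else 0) +
          (if p.1 = Site.shift q.1 μ ∧ (q.1 μ).valMinAbs = (R : ℤ) + 1 then
            (((1 : ℝ) : ℂ) • (1 : Matrix (Fin 4) (Fin 4) ℂ) + euclideanGamma μ) p.2.2 q.2.2 *
              fundamentalRep (Fin 3)
                (W' (x + Torus.proj L (fun i => ((q.1 i).valMinAbs : ℤ)), μ))⁻¹ p.2.1 q.2.1
          else 0)) := by
  refine Finset.sum_congr rfl fun μ _ => ?_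
  congr 1
  · split_ifs with hc
    · rw [h p.1 μ hc.2]
    · rfl
  · split_ifs with hc
    · rw [h q.1 μ hc.2]
    · rfl

/-- If `p.1` or `q.1` lies in the cube `0 + proj(box 4 R)` of the small torus, there is no seam hop
between `p` and `q`. -/
theorem recentreDirac_seam_eq_zero (R L : ℕ) (x : TorusSite 4 L) (W : GaugeConfig 4 L SU3)
    {p q : QuarkIdx (2 * R + 3)}
    (hpq : (∃ y ∈ box 4 R, p.1 = 0 + Torus.proj (2 * R + 3) y) ∨
      ∃ y ∈ box 4 R, q.1 = 0 + Torus.proj (2 * R + 3) y) :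
    (∑ μ : Fin 4,
        ((if q.1 = Site.shift p.1 μ ∧ (p.1 μ).valMinAbs = (R : ℤ) + 1 then
            (((1 : ℝ) : ℂ) • (1 : Matrix (Fin 4) (Fin 4) ℂ) - euclideanGamma μ) p.2.2 q.2.2 *
              fundamentalRep (Fin 3)
                (W (x + Torus.proj L (fun i => ((p.1 i).valMinAbs : ℤ)), μ)) p.2.1 q.2.1
          else 0) +
          (if p.1 = Site.shift q.1 μ ∧ (q.1 μ).valMinAbs = (R : ℤ) + 1 then
            (((1 : ℝ) : ℂ) • (1 : Matrix (Fin 4) (Fin 4) ℂ) + euclideanGamma μ) p.2.2 q.2.2 *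
              fundamentalRep (Fin 3)
                (W (x + Torus.proj L (fun i => ((q.1 i).valMinAbs : ℤ)), μ))⁻¹ p.2.1 q.2.1
          else 0))) = 0 := by
  refine Finset.sum_eq_zero fun μ _ => ?_
  have hA : ¬ (q.1 = Site.shift p.1 μ ∧ (p.1 μ).valMinAbs = (R : ℤ) + 1) := fun hc =>
    (recentreDirac_seam_not_mem R hc.1 hc.2).elim fun hp hq => hpq.elim hp hq
  have hB : ¬ (p.1 = Site.shift q.1 μ ∧ (q.1 μ).valMinAbs = (R : ℤ) + 1) := fun hc =>
    (recentreDirac_seam_not_mem R hc.1 hc.2).elim fun hq hp => hpq.elim hp hq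
  rw [if_neg hA, if_neg hB, add_zero]

/-- **Independence of the seam correction.**  The difference between `H^{(L)}(W)` sampled at
recentred indices and `H^{(L₀)}(W ∘ ι)` is the same for any two configurations agreeing on the
links based at recentred seam sites, and for any two masses. -/
theorem recentreDirac_bracket_eq (R L : ℕ) [NeZero L] [NeZero (2 * R + 3)] (hL : 2 * R + 4 ≤ L)
    (x : TorusSite 4 L) (W W' : GaugeConfig 4 L SU3)
    (h : ∀ (s : TorusSite 4 (2 * R + 3)) (μ : Fin 4), (s μ).valMinAbs = (R : ℤ) + 1 →
      W (x + Torus.proj L (fun i => ((s i).valMinAbs : ℤ)), μ) =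
        W' (x + Torus.proj L (fun i => ((s i).valMinAbs : ℤ)), μ))
    (m m' : ℝ) (p q : QuarkIdx (2 * R + 3)) :
    (spinorLift gammaFive * wilsonDirac (fundamentalRep (Fin 3)) W m 1 :
        Matrix (QuarkIdx L) (QuarkIdx L) ℂ)
        (x + Torus.proj L (fun i => ((p.1 i).valMinAbs : ℤ)), p.2)
        (x + Torus.proj L (fun i => ((q.1 i).valMinAbs : ℤ)), q.2) -
      (spinorLift gammaFive * wilsonDirac (fundamentalRep (Fin 3))
          (fun e : Edge 4 (2 * R + 3) =>
            W (x + Torus.proj L (fun i => ((e.1 i).valMinAbs : ℤ)), e.2)) m 1 :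
        Matrix (QuarkIdx (2 * R + 3)) (QuarkIdx (2 * R + 3)) ℂ) p q =
    (spinorLift gammaFive * wilsonDirac (fundamentalRep (Fin 3)) W' m' 1 :
        Matrix (QuarkIdx L) (QuarkIdx L) ℂ)
        (x + Torus.proj L (fun i => ((p.1 i).valMinAbs : ℤ)), p.2)
        (x + Torus.proj L (fun i => ((q.1 i).valMinAbs : ℤ)), q.2) -
      (spinorLift gammaFive * wilsonDirac (fundamentalRep (Fin 3))
          (fun e : Edge 4 (2 * R + 3) =>
            W' (x + Torus.proj L (fun i => ((e.1 i).valMinAbs : ℤ)), e.2)) m' 1 :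
        Matrix (QuarkIdx (2 * R + 3)) (QuarkIdx (2 * R + 3)) ℂ) p q := by
  rw [recentreDirac_gammaFive_sample R L hL x W m p q,
    recentreDirac_gammaFive_sample R L hL x W' m' p q, recentreDirac_seam_congr R L x W W' h p q]
  ring

/-! ### The stub -/

/-- **Stub `recentreDirac` (seam bookkeeping).**  For `L₀ = 2R+3`, `L ≥ 2R+4`, read the glued
configuration on the `L`-torus through the recentring
`ι : (s, μ) ↦ (x + proj_L (valMinAbs ∘ s), μ)`; then the matrix of `Γ₅ D_W` on the `L`-torus,
sampled at recentred indices, equals the matrix of `Γ₅ D_W` of the pulled-back configuration on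
the `L₀`-torus MINUS a Hermitian correction `Θ` collecting the hops of the `L₀`-torus across its
seam, which is supported off the cube `0 + proj(box R)` in both indices and depends neither on the
cell links `V` nor on `m₀`. -/
theorem stub_recentreDirac (R L₀ : ℕ) [NeZero L₀] (hL₀ : L₀ = 2 * R + 3) (L : ℕ) [NeZero L]
    (hL : 2 * R + 4 ≤ L) (x : TorusSite 4 L) (U : GaugeConfig 4 L SU3) :
    ∃ Θ : Matrix (QuarkIdx L₀) (QuarkIdx L₀) ℂ, Θ.IsHermitian ∧
      (∀ p q : QuarkIdx L₀, ((∃ y ∈ box 4 R, p.1 = 0 + Torus.proj L₀ y) ∨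
          (∃ y ∈ box 4 R, q.1 = 0 + Torus.proj L₀ y)) → Θ p q = 0) ∧
      ∀ (V : GaugeConfig 4 L SU3) (m₀ : ℝ) (p q : QuarkIdx L₀),
        (spinorLift gammaFive * wilsonDirac (fundamentalRep (Fin 3))
            (fun e => if (∃ y ∈ box 4 R, e.1 = x + Torus.proj L y) then V e else U e) m₀ 1 :
          Matrix (QuarkIdx L) (QuarkIdx L) ℂ)
          (x + Torus.proj L (fun i => ((p.1 i).valMinAbs : ℤ)), p.2)
          (x + Torus.proj L (fun i => ((q.1 i).valMinAbs : ℤ)), q.2) =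
        (spinorLift gammaFive * wilsonDirac (fundamentalRep (Fin 3))
            (fun e : Edge 4 L₀ =>
              (fun e' : Edge 4 L => if (∃ y ∈ box 4 R, e'.1 = x + Torus.proj L y) then V e' else U e')
                (x + Torus.proj L (fun i => ((e.1 i).valMinAbs : ℤ)), e.2)) m₀ 1 - Θ :
          Matrix (QuarkIdx L₀) (QuarkIdx L₀) ℂ) p q := by
  subst hL₀
  refine ⟨(spinorLift gammaFive * wilsonDirac (fundamentalRep (Fin 3))
        (fun e : Edge 4 (2 * R + 3) =>
          U (x + Torus.proj L (fun i => ((e.1 i).valMinAbs : ℤ)), e.2)) 0 1 :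
        Matrix (QuarkIdx (2 * R + 3)) (QuarkIdx (2 * R + 3)) ℂ) -
      (spinorLift gammaFive * wilsonDirac (fundamentalRep (Fin 3)) U 0 1 :
        Matrix (QuarkIdx L) (QuarkIdx L) ℂ).submatrix
        (fun p : QuarkIdx (2 * R + 3) =>
          ((x + Torus.proj L (fun i => ((p.1 i).valMinAbs : ℤ)), p.2) : QuarkIdx L))
        (fun p : QuarkIdx (2 * R + 3) =>
          ((x + Torus.proj L (fun i => ((p.1 i).valMinAbs : ℤ)), p.2) : QuarkIdx L)),
    ?_, ?_, ?_⟩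
  · -- Hermitian: difference of a Hermitian matrix and a principal reindexing of one
    exact (isHermitian_gammaFive_mul_wilsonDirac _ fundamentalRep_mem_unitaryGroup _ 0 1).sub
      ((isHermitian_gammaFive_mul_wilsonDirac _ fundamentalRep_mem_unitaryGroup U 0 1).submatrix _)
  · -- support: no seam hop touches the cube `0 + proj(box R)`
    intro p q hpq
    rw [Matrix.sub_apply, Matrix.submatrix_apply, recentreDirac_gammaFive_sample R L hL x U 0 p q,
      recentreDirac_seam_eq_zero R L x U hpq]
    ring
  · -- the identity: the seam links of the glued configuration are exterior links
    intro V m₀ p q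
    have hagree : ∀ (s : TorusSite 4 (2 * R + 3)) (μ : Fin 4), (s μ).valMinAbs = (R : ℤ) + 1 →
        (fun e : Edge 4 L => if (∃ y ∈ box 4 R, e.1 = x + Torus.proj L y) then V e else U e)
            (x + Torus.proj L (fun i => ((s i).valMinAbs : ℤ)), μ) =
          U (x + Torus.proj L (fun i => ((s i).valMinAbs : ℤ)), μ) := by
      intro s μ hs
      obtain ⟨-, -, hcube, -⟩ := stub_recentreGeometry R (2 * R + 3) rfl L hL x
      have hnot : ¬ ∃ y ∈ box 4 R,
          x + Torus.proj L (fun i => ((s i).valMinAbs : ℤ)) = x + Torus.proj L y := by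
        rw [hcube]
        exact (recentreDirac_seam_not_mem R rfl hs).1
      exact if_neg hnot
    have key := recentreDirac_bracket_eq R L hL x
      (fun e : Edge 4 L => if (∃ y ∈ box 4 R, e.1 = x + Torus.proj L y) then V e else U e) U
      hagree m₀ 0 p q
    simp only [Matrix.sub_apply, Matrix.submatrix_apply] at key ⊢
    linear_combination key

end Summit.QuantumFields.QCD.Cruxes.WegnerEstimate.ResolventCell
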